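import Literature.MathematicalPhysics.QuantumFieldTheory.Balaban1983to89.Node00.OpsYSectEElimStar

/-!
# `Balaban1983to89.Node00.OpsYSectEElimStarSmall` — T. Bałaban, *Propagators for lattice gauge theories in a background field*, Commun. Math. Phys. **99**
# (1985) 389–434 [Balaban1985BackgroundPropagators], Sect. E (3.157) p. 428 with (3.35) p. 397 (and [5] = *Averaging operations for lattice gauge theories*,
# CMP **98** (1985) 17–51 [Balaban1985Averaging], (124)–(126) p. 36; [4] = *Propagators … II*, CMP **96** (1984) 223–250 [Balaban1984PropagatorsII],
# (2.154)–(2.156) pp. 249–250): THE STAR PIVOT COEFFICIENTS `K_c(V)`, `K_c(V)*` ARE UNITS FOR SMALL FIELDS — STAR EDITION, PART 3′ (the star twins of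
# `Node00.OpsYSectEElimSmall` §2–§3 named in `Node00.OpsYSectEElimStar`'s honest margin (ii))

statement-level estimates with citation tags; proofs where landed; nothing here is a claim about the Yang–Mills mass gap, the continuum limit or OS.

`Node00.OpsYSectEElimStar` (STAR EDITION part 3) builds the letter `C(V) = elimCstY` of (3.157) and its flat transpose `C(V)* = elimCtstY` in print's STAR
convention — constraints `(Q(V)B)(c) = 0` at EVERY `L`-corner `c` with at least one good end block (`CBondStY`), pivot `b₀(c)` (`pivIStY`), pivot
coefficient `K_c(V) = KstY : a ↦ (Q(V)(δ_{b₀(c)} ⊗ a))(c)` inverted by `Ring.inverse` — and its faces `Q1Y_elimCstY (hK)`, `elimCstY_eq_self_of_constraints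
(hK)`, `sum_tr_elimCstY_mul (hK) (hKT)`, `sum_trace_elimC_elimCt_sectEStYOfRecordV7 (hK) (hKT)` carry the hypotheses `IsUnit (K_c(V))`, `IsUnit (K_c(V)*)`,
discharged there at `U = 1` only (`KstY_one ∕ KTstY_one`: `K_c(1) = L^{−(d+1)}·id`).  Its honest margin (ii): *«for small fields K_c(V) = L^{−(d+1)}(id +
O(|V − 1|)) is print's regime — the star twins of `OpsYSectEElimSmall` (`isUnit_KY_of_smallVY`, …) are NOT typed here (successor, on word)»*.

THIS FILE types them.  In the SMALL-FIELD REGIME `SmallVY x 𝔳 G U δ` of `OpsYSectEElimSmall` (the averaged bond field `V = 𝔳 U` takes values in a group of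
contractions `G` (`‖g‖ ≤ 1`, e.g. `U(N)`), `‖V(b) − 1‖ ≤ δ` on every unit bond, `L^{d+1}·2δ·(L + (d+1)ℓ) < 1`) the STAR pivot coefficients and their
transposes are UNITS of the complete fibre at EVERY star corner: `‖K_c(V)a − L^{−(d+1)}a‖ ≤ 2δ(L + (d+1)ℓ)‖a‖` (`norm_KstY_sub_le`; `norm_KTstY_sub_le` for
the transposed readings), whence `L^{d+1}K_c(V) = 1 − T`, `‖T‖ < 1` (`OpsYSectEElimSmall.isUnit_of_norm_smul_sub_le`, Neumann series) — `isUnit_KstY_of_small`,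
`isUnit_KTstY_of_small`, `isUnit_KstY_of_smallVY`, `isUnit_KTstY_of_smallVY` (and `isUnit_K[T]stY_toSt_iff`: on the old corners these ARE
`OpsYSectEElimSmall`'s units, `rfl`).  THE COUNT USES THE CORNER ONLY: each of the `L·L^{d+1}` (segment, bond) readings of the pivot in `(Q(V)·)(c)`
is carried by at most `L + (d+1)ℓ` near-identity transports (the straight segment `[z, z(c)]` and the block comb
`Γ_{c₋,z}`, `length_uΓ_le` — which bounds the EMPTY comb too, so the estimate holds whether one or both end blocks of `c` are good, exactly as
`KstY_one ∕ KTstY_one` reuse `KY_one`'s count); the proofs are `OpsYSectEElimSmall.norm_KY_sub_le ∕ norm_KTY_sub_le`'s under the token map `KY ↦ KstY`,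
`KTY ↦ KTstY`, `CBondY ↦ CBondStY`, `pivIY ↦ pivIStY`.  Print: [5] p. 36 — the operators in (124) beyond the main term *«can be estimated by O(L²α₀)»*,
(126) `|(Q(V₀)A)_c| ≤ (1 + O(1)L²α₀)α₁`; [B9] p. 428 *«(CB)(b₀) is equal to a solution of the equation (QB)(c) = 0 considered as an equation on the
variable B(b₀)»*.

CONSEQUENCES (§2–§3): part 3's three faces HYPOTHESIS-FREE for small fields, STAR — `Q1Y_elimCstY_of_smallVY` (the constraints hold on the range of `C(V)`
at every star corner), `elimCstY_eq_self_of_constraints_of_smallVY` («B = CB̃» is a parametrisation), `sum_tr_elimCstY_mul_of_smallVY` (`C*` is the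
trace-transpose of `C`); ★★ `elimCstY_mem_starSubspace_of_smallVY` — part 3 §7's DOOR TRIPLE `⟨B = 0 off inΛstY, B = 0 on the axial trees, (Q(V)B)(c) = 0
at every star corner⟩` for `B := C_st(V)Φ` at a GENERAL small `V` (§7 has it at `U = 1`); and at the record (`M_N(ℂ)`, `G ≤ U(N)`, `V = avYOfRecord x U`,
`OpsYSectEElimSmall.smallVY_avYOfRecord`): `isUnit_KstY_avYOfRecord_of_small ∕ isUnit_KTstY_avYOfRecord_of_small`,
`sum_trace_elimC_elimCt_sectEStYOfRecordV7_of_smallVY`, `Q1Y_elimC_sectEStYOfRecordV7_of_smallVY`,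
`elimC_sectEStYOfRecordV7_eq_self_of_constraints_of_smallVY`, `sectEStYOfRecordV7_elimC_mem_starSubspace_of_smallVY`.

CONSUMER (dag-n08-b p693372 `B1Eq324BenfattoClassSectEMemberPrecisionDoorAtOneStar` §2): `coercive_CsDeltaCPstY_of_ineq2153_of_units … (hK : ∀ c :
CBondStY x, IsUnit (KstY x 𝔳 U c)) (hKT : ∀ c, IsUnit (KTstY x 𝔳 U c)) …` — the general-background transfer «(2.153) on the `V`-constrained star subspace
⇒ the `γ` row of `η^{d+1}C_st(V)*Δ_k(U)C_st(V)`» modulo the star pivot units; `isUnit_KstY_of_smallVY x 𝔳 h ∕ isUnit_KTstY_of_smallVY x 𝔳 h` ARE those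
two binders in the small-field regime.

## Honest margins
(i) PRINT'S REGIME IS WIDER (as `OpsYSectEElimSmall` margin (i)): (3.35) ∕ [5] (109) is small CURVATURE; the reduction «small curvature ⇒ gauge
equivalent to a small field» is NOT formalised here, and the GAUGE-ORBIT rows of `OpsYSectEElimSmall` §5 (`isUnit_KY_ugauge_iff`,
`isUnit_KY_of_ugauge_smallVY`, …) are NOT twinned: their engine `Q1Y_ugauge` asks the SOURCE block `B(c₋)` good, and at a star corner with only `c₊` good
the tree's `Q(V)` carries no comb transport inside `B(c₋)` (`uΓ = []` off `Λ′`, part 3 margin (iv): exact at `U = 1`, a declared dictionary elsewhere),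
so it is not gauge covariant there and no star twin of §5 is claimed.  The smallness is asked on ALL unit bonds (print needs it near `c` only).
(ii) CONSTANTS are `OpsYSectEElimSmall`'s (`2δ(L + (d+1)ℓ)·L^{d+1}`, cruder than print's `O(L²α₀)`; `d, L` only).
(iii) Nothing here touches the (2.153) ∕ `γ₀` row at a general background (print p. 428 «localizing … the methods of Sect. B» — node N06's G-B9-09),
nor `⟨D̃⁽²⁾, J⟩`, `G̃₂`, nor (3.158)–(3.185); no door is assembled here.
(iv) `U = 1` is the case `δ = 0` (`OpsYSectEElimSmall.smallVY_avYOfRecord_one`), consistent with part 3's unconditional `U = 1` faces.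
Net new unproved facts: 0.  Filed by seat dag-n08-d (g39) under node00-def-Y's directory and namespace, BY NAME over parts 1–3 (nothing re-declared); the
node00-def-Y successor reviews ∕ extends by name.
-/

noncomputable section

namespace Literature.MathematicalPhysics.QuantumFieldTheory.Balaban1983to89.Node00

open B9Eq3169Mu
open B9Eq39Adjoint (R R_one)
open B9PinMembersKLevelV1 (MemberY)
open B6GlobalChartV1 (PV domT)
open B6BondElimination (unitVec)

variable {d ℓ : ℕ} {hd : 1 ≤ d + 1} {hL : Odd (ℓ + 1) ∧ 1 < ℓ + 1} {b₀ b₁ : ℝ} {Mstar : ℕ}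

/-! ## §1 The star pivot coefficients `K_c(V)`, `K_c(V)*` in the small-field regime -/

section SmallKSt

variable {𝔸 : Type} [NormedRing 𝔸] [NormedAlgebra ℂ 𝔸] [CompleteSpace 𝔸]
variable (x : MemberY d ℓ hd hL b₀ b₁ Mstar) (𝔳 : AvY 𝔸 x)

open Classical in
/-- ★★ **SMALL FIELDS MOVE THE STAR PIVOT COEFFICIENT LITTLE**: for a bond field `V = 𝔳 U` with values in a group of contractions (`‖g‖ ≤ 1`) and
`‖V(b) − 1‖ ≤ δ` on every unit bond, `‖K_c(V)a − L^{−(d+1)}a‖ ≤ 2δ·(L + (d+1)ℓ)·‖a‖` at EVERY star corner `c` (at least one good end block) — each of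
the `L·L^{d+1}` (segment, bond) readings of the pivot is carried by at most `L + (d+1)ℓ` near-identity transports; the count uses the corner only
(`OpsYSectEElimSmall.norm_KY_sub_le`'s proof under `KY ↦ KstY`, `pivIY ↦ pivIStY`; the comb bound `length_uΓ_le` covers the empty comb of a non-good
source block). [cite: Balaban1985Averaging, (125)–(126) p.36; Balaban1985BackgroundPropagators, (3.35) p.397, p.428; Balaban1984PropagatorsII, Lemma 2.4 p.245 (star Λ)] -/
theorem norm_KstY_sub_le {G : Subgroup 𝔸ˣ} (hG1 : ∀ g ∈ G, ‖((g : 𝔸ˣ) : 𝔸)‖ ≤ 1) {U : CfgY 𝔸 x.toKIdx} (h𝔳 : ∀ b, 𝔳 U b ∈ G) {δ : ℝ} (hδ0 : 0 ≤ δ)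
    (hδ : ∀ b, ‖((𝔳 U b : 𝔸ˣ) : 𝔸) - 1‖ ≤ δ) (c : CBondStY x) (a : 𝔸) :
    ‖KstY x 𝔳 U c a - ((((ℓ + 1 : ℕ) : ℂ)) ^ (d + 1))⁻¹ • a‖ ≤ 2 * δ * (((ℓ + 1 : ℕ) + (d + 1) * ℓ : ℕ) : ℝ) * ‖a‖ := by
  rw [← KstY_one x c a]
  obtain ⟨⟨y, μ⟩, hc⟩ := c
  have hT : ∀ (b : UBondY x) (v : 𝔸), ‖RUY x 𝔳 U b v‖ ≤ ‖v‖ := fun b v => by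
    rw [RUY_apply]; exact B9Eq310Hermitian.norm_R_le (hG1 _ (h𝔳 b)) (hG1 _ (G.inv_mem (h𝔳 b))) v
  have hTδ : ∀ (b : UBondY x) (v : 𝔸), ‖RUY x 𝔳 U b v - v‖ ≤ (2 * δ) * ‖v‖ := fun b v => by
    rw [RUY_apply]; exact norm_R_sub_self_le_of_le (hG1 _ (G.inv_mem (h𝔳 b))) (hδ b) v
  have hT' : ∀ (q : IBondY x.toKIdx) (v : 𝔸), ‖RVY x 𝔳 U q v‖ ≤ ‖v‖ := fun q v => hT _ v
  have hT'δ : ∀ (q : IBondY x.toKIdx) (v : 𝔸), ‖RVY x 𝔳 U q v - v‖ ≤ (2 * δ) * ‖v‖ := fun q v => hTδ _ v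
  have h1T : ∀ (b : UBondY x) (v : 𝔸), RUY x (avYOfRecord x) (fun _ _ => 1 : CfgY 𝔸 x.toKIdx) b v = v := fun b v => by
    rw [RUY_apply, avYOfRecord_one, R_one]
  set B : UBondY x → 𝔸 := readUY x (Pi.single (pivIStY x ⟨(y, μ), hc⟩) a) with hB
  have hBle : ∀ b, ‖B b‖ ≤ ‖a‖ := by
    intro b
    rw [hB]
    unfold pivIStY
    rw [readUY_single]
    split_ifs
    · exact le_rfl
    · rw [norm_zero]; exact norm_nonneg a
  rw [KstY_apply, KstY_apply, Q1Y_apply, Q1Y_apply, ← smul_sub, ← Finset.sum_sub_distrib, norm_smul, norm_qNormY]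
  simp only [hol_apply_of_id _ (RVY_avYOfRecord_one x), trSum_of_id _ h1T]
  have hz : ∀ z ∈ ublockY x y,
      ‖hol (RVY x 𝔳 U) (uΓ x z) (trSum (RUY x 𝔳 U) B (usegY x z μ)) - ((usegY x z μ).map B).sum‖ ≤
        2 * δ * (((ℓ + 1 : ℕ) + (d + 1) * ℓ : ℕ) : ℝ) * (((ℓ + 1 : ℕ) : ℝ) * ‖a‖) := by
    intro z _
    have e : hol (RVY x 𝔳 U) (uΓ x z) (trSum (RUY x 𝔳 U) B (usegY x z μ)) - ((usegY x z μ).map B).sum =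
        hol (RVY x 𝔳 U) (uΓ x z) (trSum (RUY x 𝔳 U) B (usegY x z μ) - ((usegY x z μ).map B).sum) +
          (hol (RVY x 𝔳 U) (uΓ x z) ((usegY x z μ).map B).sum - ((usegY x z μ).map B).sum) := by
      rw [map_sub]; abel
    rw [e]
    refine (norm_add_le _ _).trans ?_
    have i1 := (norm_hol_le _ hT' (uΓ x z) _).trans (norm_trSum_sub_sum_le _ hT (by positivity) hTδ B (norm_nonneg a) hBle (usegY x z μ))
    have i3 := norm_hol_sub_self_le _ hT' hT'δ (uΓ x z) ((usegY x z μ).map B).sum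
    have i4 := norm_list_sum_map_le B hBle (usegY x z μ)
    have i5 : ((uΓ x z).length : ℝ) ≤ ((d + 1) * ℓ : ℕ) := length_uΓ_le x z
    rw [length_usegY] at i1 i4
    have i6 : ((uΓ x z).length : ℝ) * (2 * δ) * ‖((usegY x z μ).map B).sum‖ ≤ (((d + 1) * ℓ : ℕ) : ℝ) * (2 * δ) * ((((ℓ + 1 : ℕ)) : ℝ) * ‖a‖) := by
      exact mul_le_mul (mul_le_mul_of_nonneg_right i5 (by positivity)) i4 (norm_nonneg _) (by positivity)
    have := norm_nonneg a
    push_cast at i1 i5 i6 ⊢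
    nlinarith
  refine (mul_le_mul_of_nonneg_left ((norm_sum_le _ _).trans (Finset.sum_le_card_nsmul _ _ _ hz)) (by positivity)).trans ?_
  rw [nsmul_eq_mul]
  have hcard : ((ublockY x y).card : ℝ) ≤ (((ℓ + 1 : ℕ) : ℝ)) ^ (d + 1) := by exact_mod_cast card_ublockY_le x y
  have hL : (0 : ℝ) < ((ℓ + 1 : ℕ) : ℝ) := by exact_mod_cast Nat.succ_pos ℓ
  have hK : (0 : ℝ) ≤ 2 * δ * (((ℓ + 1 : ℕ) + (d + 1) * ℓ : ℕ) : ℝ) * (((ℓ + 1 : ℕ) : ℝ) * ‖a‖) := by positivity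
  calc ((((ℓ + 1 : ℕ) : ℝ)) ^ (d + 2))⁻¹ * (((ublockY x y).card : ℝ) * (2 * δ * (((ℓ + 1 : ℕ) + (d + 1) * ℓ : ℕ) : ℝ) * (((ℓ + 1 : ℕ) : ℝ) * ‖a‖)))
      ≤ ((((ℓ + 1 : ℕ) : ℝ)) ^ (d + 2))⁻¹ * ((((ℓ + 1 : ℕ) : ℝ)) ^ (d + 1) * (2 * δ * (((ℓ + 1 : ℕ) + (d + 1) * ℓ : ℕ) : ℝ) * (((ℓ + 1 : ℕ) : ℝ) * ‖a‖))) := by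
        gcongr
    _ = 2 * δ * (((ℓ + 1 : ℕ) + (d + 1) * ℓ : ℕ) : ℝ) * ‖a‖ := by
        field_simp
        ring

/-- ★★★ **SMALL FIELDS: THE STAR PIVOT COEFFICIENT IS A UNIT AT EVERY STAR CORNER** — for `‖V(b) − 1‖ ≤ δ` with `2δ·L^{d+1}(L + (d+1)ℓ) < 1`,
`K_c(V)` is invertible on the (complete) fibre: `L^{d+1}K_c(V) = 1 − T` with `‖T‖ < 1` (Neumann series, `OpsYSectEElimSmall.isUnit_of_norm_smul_sub_le`).
[cite: Balaban1985BackgroundPropagators, (3.35) p.397, p.428 («considered as an equation on the variable B(b₀)»); Balaban1985Averaging, (126) p.36; Balaban1984PropagatorsII, Lemma 2.4 p.245] -/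
theorem isUnit_KstY_of_small {G : Subgroup 𝔸ˣ} (hG1 : ∀ g ∈ G, ‖((g : 𝔸ˣ) : 𝔸)‖ ≤ 1) {U : CfgY 𝔸 x.toKIdx} (h𝔳 : ∀ b, 𝔳 U b ∈ G) {δ : ℝ} (hδ0 : 0 ≤ δ)
    (hδ : ∀ b, ‖((𝔳 U b : 𝔸ˣ) : 𝔸) - 1‖ ≤ δ)
    (hsmall : (((ℓ + 1 : ℕ) : ℝ)) ^ (d + 1) * (2 * δ * (((ℓ + 1 : ℕ) + (d + 1) * ℓ : ℕ) : ℝ)) < 1) (c : CBondStY x) :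
    IsUnit (KstY x 𝔳 U c) := by
  have hLp0 : ((((ℓ + 1 : ℕ) : ℂ)) ^ (d + 1)) ≠ 0 := pow_ne_zero _ (Nat.cast_ne_zero.2 (Nat.succ_ne_zero ℓ))
  have hLpn : ‖(((ℓ + 1 : ℕ) : ℂ)) ^ (d + 1)‖ = (((ℓ + 1 : ℕ) : ℝ)) ^ (d + 1) := by rw [norm_pow, Complex.norm_natCast]
  refine isUnit_of_norm_smul_sub_le (KstY x 𝔳 U c) hLp0 (by positivity) hsmall (fun a => ?_)
  have e : ((((ℓ + 1 : ℕ) : ℂ)) ^ (d + 1) • KstY x 𝔳 U c) a - a =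
      (((ℓ + 1 : ℕ) : ℂ)) ^ (d + 1) • (KstY x 𝔳 U c a - ((((ℓ + 1 : ℕ) : ℂ)) ^ (d + 1))⁻¹ • a) := by
    rw [LinearMap.smul_apply, smul_sub, smul_inv_smul₀ hLp0]
  rw [e, norm_smul, hLpn, mul_assoc]
  exact mul_le_mul_of_nonneg_left (by simpa only [mul_assoc] using norm_KstY_sub_le x 𝔳 hG1 h𝔳 hδ0 hδ c a) (by positivity)

open Classical in
/-- ★★ **SMALL FIELDS MOVE THE TRANSPOSED STAR PIVOT COEFFICIENT LITTLE**: `‖K_c(V)*v − L^{−(d+1)}v‖ ≤ 2δ·(L + (d+1)ℓ)·‖v‖` at every star corner under the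
hypotheses of `norm_KstY_sub_le` (the transposed readings are carried by the inverse transports `Ad(V(b)⁻¹)`, `R(V(Γ))⁻¹`, equally close to `1`;
`OpsYSectEElimSmall.norm_KTY_sub_le`'s proof under `KTY ↦ KTstY`, `pivIY ↦ pivIStY`). [cite: Balaban1985Averaging, (125)–(126) p.36; Balaban1985BackgroundPropagators, (3.35) p.397, (3.9) p.392, p.428] -/
theorem norm_KTstY_sub_le {G : Subgroup 𝔸ˣ} (hG1 : ∀ g ∈ G, ‖((g : 𝔸ˣ) : 𝔸)‖ ≤ 1) {U : CfgY 𝔸 x.toKIdx} (h𝔳 : ∀ b, 𝔳 U b ∈ G) {δ : ℝ} (hδ0 : 0 ≤ δ)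
    (hδ : ∀ b, ‖((𝔳 U b : 𝔸ˣ) : 𝔸) - 1‖ ≤ δ) (c : CBondStY x) (v : 𝔸) :
    ‖KTstY x 𝔳 U c v - ((((ℓ + 1 : ℕ) : ℂ)) ^ (d + 1))⁻¹ • v‖ ≤ 2 * δ * (((ℓ + 1 : ℕ) + (d + 1) * ℓ : ℕ) : ℝ) * ‖v‖ := by
  rw [← KstY_one x c v]
  obtain ⟨⟨y, μ⟩, hc⟩ := c
  have hS : ∀ (b : UBondY x) (w : 𝔸), ‖RUTY x 𝔳 U b w‖ ≤ ‖w‖ := fun b w => by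
    rw [RUTY_apply]
    exact B9Eq310Hermitian.norm_R_le (hG1 _ (G.inv_mem (h𝔳 b))) (by rw [inv_inv]; exact hG1 _ (h𝔳 b)) w
  have hSδ : ∀ (b : UBondY x) (w : 𝔸), ‖RUTY x 𝔳 U b w - w‖ ≤ (2 * δ) * ‖w‖ := fun b w => by
    rw [RUTY_apply]
    refine norm_R_sub_self_le_of_le (V := (𝔳 U b)⁻¹) (by rw [inv_inv]; exact hG1 _ (h𝔳 b)) ?_ w
    exact ((B9Eq369Small.norm_inv_sub_one_le (hG1 _ (G.inv_mem (h𝔳 b)))).trans (by rw [one_mul])).trans (hδ b)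
  have hT' : ∀ (q : IBondY x.toKIdx) (w : 𝔸), ‖(RVY x 𝔳 U q).symm w‖ ≤ ‖w‖ := fun q w => hS (ubondOfIdx x q) w
  have hT'δ : ∀ (q : IBondY x.toKIdx) (w : 𝔸), ‖(RVY x 𝔳 U q).symm w - w‖ ≤ (2 * δ) * ‖w‖ := fun q w => hSδ (ubondOfIdx x q) w
  have h1T : ∀ (b : UBondY x) (w : 𝔸), RUY x (avYOfRecord x) (fun _ _ => 1 : CfgY 𝔸 x.toKIdx) b w = w := fun b w => by
    rw [RUY_apply, avYOfRecord_one, R_one]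
  rw [KTstY_apply, KstY_apply, Q1TY_apply, Q1Y_apply, Pi.smul_apply, ← smul_sub]
  unfold q1TFunY
  rw [Finset.sum_apply, ← Finset.sum_sub_distrib, norm_smul, norm_qNormY]
  unfold pivIStY
  have hB : readUY x (Pi.single (idxOfU x (upivU x (y, μ)) (upivU_src_mem_Om_st x ((mem_coarseStY x).1 hc))) v) =
      fun b => if b = upivU x (y, μ) then v else 0 := funext fun b => readUY_single x _ _ v b
  simp only [hol_apply_of_id _ (RVY_avYOfRecord_one x), trSum_of_id _ h1T, hB, placeUY_idxOfU, list_sum_map_ite_eq]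
  have hz : ∀ z ∈ ublockY x y,
      ‖trSumT (RUTY x 𝔳 U) (usegY x z μ) ((hol (RVY x 𝔳 U) (uΓ x z)).symm v) (upivU x (y, μ)) - occY (upivU x (y, μ)) (usegY x z μ) • v‖ ≤
        2 * δ * (((ℓ + 1 : ℕ) + (d + 1) * ℓ : ℕ) : ℝ) * (((ℓ + 1 : ℕ) : ℝ) * ‖v‖) := by
    intro z _
    set w := (hol (RVY x 𝔳 U) (uΓ x z)).symm v with hw
    have e : trSumT (RUTY x 𝔳 U) (usegY x z μ) w (upivU x (y, μ)) - occY (upivU x (y, μ)) (usegY x z μ) • v =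
        (trSumT (RUTY x 𝔳 U) (usegY x z μ) w (upivU x (y, μ)) - occY (upivU x (y, μ)) (usegY x z μ) • w) +
          occY (upivU x (y, μ)) (usegY x z μ) • (w - v) := by
      rw [smul_sub]; abel
    rw [e]
    refine (norm_add_le _ _).trans ?_
    have hwv : ‖w‖ ≤ ‖v‖ := norm_hol_symm_le _ hT' (uΓ x z) v
    have i1 := (norm_trSumT_sub_occY_le _ hS (by positivity) hSδ (upivU x (y, μ)) (usegY x z μ) w).trans
      (mul_le_mul_of_nonneg_left hwv (by positivity))
    have i3 : ‖w - v‖ ≤ (uΓ x z).length * (2 * δ) * ‖v‖ := norm_hol_symm_sub_self_le _ hT' (by positivity) hT'δ (uΓ x z) v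
    have i5 : ((uΓ x z).length : ℝ) ≤ ((d + 1) * ℓ : ℕ) := length_uΓ_le x z
    have i2 : ‖occY (upivU x (y, μ)) (usegY x z μ) • (w - v)‖ ≤ ((ℓ + 1 : ℕ) : ℝ) * (((d + 1) * ℓ : ℕ) * (2 * δ) * ‖v‖) := by
      rw [norm_smul, Real.norm_of_nonneg (occY_nonneg _ _)]
      refine mul_le_mul ((occY_le_length _ _).trans (by rw [length_usegY])) (i3.trans ?_) (norm_nonneg _) (by positivity)
      exact mul_le_mul_of_nonneg_right (mul_le_mul_of_nonneg_right i5 (by positivity)) (norm_nonneg v)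
    rw [length_usegY] at i1
    have := norm_nonneg v
    push_cast at i1 i2 ⊢
    nlinarith
  refine (mul_le_mul_of_nonneg_left ((norm_sum_le _ _).trans (Finset.sum_le_card_nsmul _ _ _ hz)) (by positivity)).trans ?_
  rw [nsmul_eq_mul]
  have hcard : ((ublockY x y).card : ℝ) ≤ (((ℓ + 1 : ℕ) : ℝ)) ^ (d + 1) := by exact_mod_cast card_ublockY_le x y
  have hL : (0 : ℝ) < ((ℓ + 1 : ℕ) : ℝ) := by exact_mod_cast Nat.succ_pos ℓ
  have hK : (0 : ℝ) ≤ 2 * δ * (((ℓ + 1 : ℕ) + (d + 1) * ℓ : ℕ) : ℝ) * (((ℓ + 1 : ℕ) : ℝ) * ‖v‖) := by positivity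
  calc ((((ℓ + 1 : ℕ) : ℝ)) ^ (d + 2))⁻¹ * (((ublockY x y).card : ℝ) * (2 * δ * (((ℓ + 1 : ℕ) + (d + 1) * ℓ : ℕ) : ℝ) * (((ℓ + 1 : ℕ) : ℝ) * ‖v‖)))
      ≤ ((((ℓ + 1 : ℕ) : ℝ)) ^ (d + 2))⁻¹ * ((((ℓ + 1 : ℕ) : ℝ)) ^ (d + 1) * (2 * δ * (((ℓ + 1 : ℕ) + (d + 1) * ℓ : ℕ) : ℝ) * (((ℓ + 1 : ℕ) : ℝ) * ‖v‖))) := by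
        gcongr
    _ = 2 * δ * (((ℓ + 1 : ℕ) + (d + 1) * ℓ : ℕ) : ℝ) * ‖v‖ := by
        field_simp
        ring

/-- ★★★ **SMALL FIELDS: THE TRANSPOSED STAR PIVOT COEFFICIENT IS A UNIT AT EVERY STAR CORNER** (same smallness as `isUnit_KstY_of_small`); hence the
adjointness face `sum_tr_elimCstY_mul` holds hypothesis-free in the small-field regime. [cite: Balaban1985BackgroundPropagators, (3.35) p.397, (3.9) p.392, p.428] -/
theorem isUnit_KTstY_of_small {G : Subgroup 𝔸ˣ} (hG1 : ∀ g ∈ G, ‖((g : 𝔸ˣ) : 𝔸)‖ ≤ 1) {U : CfgY 𝔸 x.toKIdx} (h𝔳 : ∀ b, 𝔳 U b ∈ G) {δ : ℝ} (hδ0 : 0 ≤ δ)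
    (hδ : ∀ b, ‖((𝔳 U b : 𝔸ˣ) : 𝔸) - 1‖ ≤ δ)
    (hsmall : (((ℓ + 1 : ℕ) : ℝ)) ^ (d + 1) * (2 * δ * (((ℓ + 1 : ℕ) + (d + 1) * ℓ : ℕ) : ℝ)) < 1) (c : CBondStY x) :
    IsUnit (KTstY x 𝔳 U c) := by
  have hLp0 : ((((ℓ + 1 : ℕ) : ℂ)) ^ (d + 1)) ≠ 0 := pow_ne_zero _ (Nat.cast_ne_zero.2 (Nat.succ_ne_zero ℓ))
  have hLpn : ‖(((ℓ + 1 : ℕ) : ℂ)) ^ (d + 1)‖ = (((ℓ + 1 : ℕ) : ℝ)) ^ (d + 1) := by rw [norm_pow, Complex.norm_natCast]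
  refine isUnit_of_norm_smul_sub_le (KTstY x 𝔳 U c) hLp0 (by positivity) hsmall (fun a => ?_)
  have e : ((((ℓ + 1 : ℕ) : ℂ)) ^ (d + 1) • KTstY x 𝔳 U c) a - a =
      (((ℓ + 1 : ℕ) : ℂ)) ^ (d + 1) • (KTstY x 𝔳 U c a - ((((ℓ + 1 : ℕ) : ℂ)) ^ (d + 1))⁻¹ • a) := by
    rw [LinearMap.smul_apply, smul_sub, smul_inv_smul₀ hLp0]
  rw [e, norm_smul, hLpn, mul_assoc]
  exact mul_le_mul_of_nonneg_left (by simpa only [mul_assoc] using norm_KTstY_sub_le x 𝔳 hG1 h𝔳 hδ0 hδ c a) (by positivity)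

/-- ★★ in the small-field regime `SmallVY x 𝔳 G U δ` every STAR pivot coefficient is a unit — dag-n08-b's binder `hK : ∀ c : CBondStY x, IsUnit (KstY x 𝔳 U c)`
of `coercive_CsDeltaCPstY_of_ineq2153_of_units`, discharged. [cite: Balaban1985BackgroundPropagators, (3.35) p.397, p.428, bookkeeping] -/
theorem isUnit_KstY_of_smallVY {G : Subgroup 𝔸ˣ} {U : CfgY 𝔸 x.toKIdx} {δ : ℝ} (h : SmallVY x 𝔳 G U δ) (c : CBondStY x) : IsUnit (KstY x 𝔳 U c) :=
  isUnit_KstY_of_small x 𝔳 h.1 h.2.1 h.2.2.1 h.2.2.2.1 h.2.2.2.2 c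

/-- ★★ in the small-field regime every transposed STAR pivot coefficient is a unit — dag-n08-b's binder `hKT : ∀ c : CBondStY x, IsUnit (KTstY x 𝔳 U c)`,
discharged. [cite: Balaban1985BackgroundPropagators, (3.35) p.397, (3.9) p.392, p.428, bookkeeping] -/
theorem isUnit_KTstY_of_smallVY {G : Subgroup 𝔸ˣ} {U : CfgY 𝔸 x.toKIdx} {δ : ℝ} (h : SmallVY x 𝔳 G U δ) (c : CBondStY x) : IsUnit (KTstY x 𝔳 U c) :=
  isUnit_KTstY_of_small x 𝔳 h.1 h.2.1 h.2.2.1 h.2.2.2.1 h.2.2.2.2 c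

/-- on the old (both-good) corners the star pivot coefficient IS `OpsYSectEElimSmall`'s (`KstY_toSt`, `rfl`), so the star unit there is its unit — at
every background, small or not. [cite: Balaban1985BackgroundPropagators, p.428, bookkeeping] -/
theorem isUnit_KstY_toSt_iff (U : CfgY 𝔸 x.toKIdx) (c : CBondY x) : IsUnit (KstY x 𝔳 U (CBondY.toSt x c)) ↔ IsUnit (KY x 𝔳 U c) := Iff.rfl

/-- … and the same for the transposes (`KTstY_toSt`). [cite: Balaban1985BackgroundPropagators, p.428, (3.9) p.392, bookkeeping] -/
theorem isUnit_KTstY_toSt_iff (U : CfgY 𝔸 x.toKIdx) (c : CBondY x) : IsUnit (KTstY x 𝔳 U (CBondY.toSt x c)) ↔ IsUnit (KTY x 𝔳 U c) := Iff.rfl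

end SmallKSt

/-! ## §2 The faces of the star `C(V)`, `C(V)*` hypothesis-free in the small-field regime; the door triple at a general small background -/

section FacesSmallSt

variable {𝔸 : Type} [NormedRing 𝔸] [NormedAlgebra ℂ 𝔸] [CompleteSpace 𝔸]
variable (x : MemberY d ℓ hd hL b₀ b₁ Mstar) (𝔳 : AvY 𝔸 x)

/-- ★★ **SMALL FIELDS: THE RANGE OF THE STAR `C(V)` SATISFIES THE AVERAGING CONSTRAINTS `(Q(V)·)(c) = 0` AT EVERY STAR CORNER, UNCONDITIONALLY**
((3.157): «QB = 0 on Λ′», star Λ′). [cite: Balaban1985BackgroundPropagators, (3.157) p.428; Balaban1985Averaging, (125) p.36; Balaban1984PropagatorsII, Lemma 2.4 p.245] -/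
theorem Q1Y_elimCstY_of_smallVY {G : Subgroup 𝔸ˣ} {U : CfgY 𝔸 x.toKIdx} {δ : ℝ} (h : SmallVY x 𝔳 G U δ) (c : CBondStY x) (B : IBondY x.toKIdx → 𝔸) :
    Q1Y x 𝔳 U c.1 (elimCstY x 𝔳 U B) = 0 :=
  Q1Y_elimCstY x 𝔳 U (isUnit_KstY_of_smallVY x 𝔳 h c) B

/-- ★★ **SMALL FIELDS: THE STAR `C(V)` PARAMETRISES PRINT's CONSTRAINED STAR SUBSPACE** — every `B` supported on `Λ̃ ∪ {star pivots}` with `(Q(V)B)(c) = 0`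
at every star corner is `C(V)` of its restriction: `C(V)B = B`. [cite: Balaban1985BackgroundPropagators, (3.157) p.428 («an arbitrary function B on this subspace can be represented»); Balaban1984PropagatorsII, (2.154)–(2.156) pp.249–250] -/
theorem elimCstY_eq_self_of_constraints_of_smallVY {G : Subgroup 𝔸ˣ} {U : CfgY 𝔸 x.toKIdx} {δ : ℝ} (h : SmallVY x 𝔳 G U δ) (B : IBondY x.toKIdx → 𝔸)
    (hsupp : ∀ q, ¬ lamTstY x q → ¬ IsPivStY x q → B q = 0) (hQ : ∀ c : CBondStY x, Q1Y x 𝔳 U c.1 B = 0) : elimCstY x 𝔳 U B = B :=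
  elimCstY_eq_self_of_constraints x 𝔳 U B (isUnit_KstY_of_smallVY x 𝔳 h) hsupp hQ

/-- ★★ **SMALL FIELDS: THE STAR `C(V)*` IS THE FLAT TRANSPOSE OF `C(V)` UNCONDITIONALLY** — `Σ_q τ((C B)(q)·A(q)) = Σ_q τ(B(q)·(C* A)(q))` for every tracial `τ`.
[cite: Balaban1985BackgroundPropagators, (3.157) p.428 («C*»), (3.9) p.392, (3.35) p.397] -/
theorem sum_tr_elimCstY_mul_of_smallVY {G : Subgroup 𝔸ˣ} {U : CfgY 𝔸 x.toKIdx} {δ : ℝ} (h : SmallVY x 𝔳 G U δ) (τ : 𝔸 →ₗ[ℂ] ℂ)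
    (hτ : ∀ a b : 𝔸, τ (a * b) = τ (b * a)) (B A : IBondY x.toKIdx → 𝔸) :
    ∑ q, τ (elimCstY x 𝔳 U B q * A q) = ∑ q, τ (B q * elimCtstY x 𝔳 U A q) :=
  sum_tr_elimCstY_mul x 𝔳 τ hτ U (isUnit_KstY_of_smallVY x 𝔳 h) (isUnit_KTstY_of_smallVY x 𝔳 h) B A

/-- ★★ **THE DOOR TRIPLE AT A GENERAL SMALL BACKGROUND**: for every `Φ`, `B := C_st(V)Φ = elimCstY x 𝔳 U Φ` satisfies «`B = 0` off the bonds with a good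
end block» (`inΛstY`), «`B = 0` on the axial trees» (`IsAxialY`) and «`(Q(V)B)(c) = 0` at every star corner» (`CBondStY`) — part 3 §7's
`elimCstY_one_mem_starSubspace` with `U = 1` replaced by any `V` in the small-field regime (the first two conjuncts hold at every `V`; the third is
`Q1Y_elimCstY_of_smallVY`).  With `elimCstY_apply_of_lamTstY` (`B = Φ` on `Λ̃`, every `V`) these are the four facts dag-n08-b's transfer
`coercive_CsDeltaCPstY_of_ineq2153_of_units` uses of `B`. [cite: Balaban1985BackgroundPropagators, (3.156)–(3.157) p.428, (3.35) p.397; Balaban1984PropagatorsII, (2.153)–(2.156) pp.249–250, (2.3) p.224, Lemma 2.4 p.245] -/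
theorem elimCstY_mem_starSubspace_of_smallVY {G : Subgroup 𝔸ˣ} {U : CfgY 𝔸 x.toKIdx} {δ : ℝ} (h : SmallVY x 𝔳 G U δ) (Φ : IBondY x.toKIdx → 𝔸) :
    (∀ q, ¬ inΛstY x q → elimCstY x 𝔳 U Φ q = 0) ∧ (∀ q, IsAxialY x q → elimCstY x 𝔳 U Φ q = 0) ∧
      (∀ c : CBondStY x, Q1Y x 𝔳 U c.1 (elimCstY x 𝔳 U Φ) = 0) :=
  ⟨fun _ hq => elimCstY_apply_of_not_inΛstY x 𝔳 U Φ hq, fun _ hq => elimCstY_apply_of_isAxialY x 𝔳 U Φ hq,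
    fun c => Q1Y_elimCstY_of_smallVY x 𝔳 h c Φ⟩

end FacesSmallSt

/-! ## §3 Record level: the v7 star Sect. E letters in the small-field regime (fibre `M_N(ℂ)`, `G ≤ U(N)`, `V = avYOfRecord x U`) -/

section RecordV7Small

open scoped Matrix.Norms.L2Operator
open B7Prop2Explicit (unitaryUnits)

variable (N : ℕ) (θ : Stage3Params) (Mstar : ℕ) (𝔢₀ : SectEY N θ Mstar)

/-- ★★ **SMALL FIELDS OF RECORD ⇒ STAR PIVOT UNITS**: for `G ≤ U(N)`, a `G`-valued background `U` whose averaged field of record `V = avYOfRecord x U`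
satisfies `‖V(b) − 1‖ ≤ δ` on the unit bonds with `L^{d+1}·2δ(L + (d+1)ℓ) < 1` has `K_c(V)` a unit at every STAR corner
(`OpsYSectEElimSmall.smallVY_avYOfRecord` + `isUnit_KstY_of_smallVY`). [cite: Balaban1985BackgroundPropagators, (3.35) pp.396–397, (3.40) p.397, p.428] -/
theorem isUnit_KstY_avYOfRecord_of_small (x : MemberY θ.d₆ θ.ℓ₆ θ.hd' θ.hL' θ.b₀ θ.b₁ Mstar) {G : Subgroup (Matrix (Fin N) (Fin N) ℂ)ˣ}
    (hG : G ≤ unitaryUnits (Matrix (Fin N) (Fin N) ℂ)) {U : CfgY (Matrix (Fin N) (Fin N) ℂ) x.toKIdx} (hU : ∀ μ z, U μ z ∈ G) {δ : ℝ} (hδ0 : 0 ≤ δ)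
    (hδ : ∀ b, ‖((avYOfRecord x U b : (Matrix (Fin N) (Fin N) ℂ)ˣ) : Matrix (Fin N) (Fin N) ℂ) - 1‖ ≤ δ)
    (hsmall : (((θ.ℓ₆ + 1 : ℕ) : ℝ)) ^ (θ.d₆ + 1) * (2 * δ * (((θ.ℓ₆ + 1 : ℕ) + (θ.d₆ + 1) * θ.ℓ₆ : ℕ) : ℝ)) < 1) (c : CBondStY x) :
    IsUnit (KstY x (avYOfRecord x) U c) :=
  isUnit_KstY_of_smallVY x (avYOfRecord x) (smallVY_avYOfRecord N θ Mstar x hG hU hδ0 hδ hsmall) c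

/-- ★★ … and `K_c(V)*` a unit at every STAR corner. [cite: Balaban1985BackgroundPropagators, (3.35) pp.396–397, (3.9) p.392, p.428] -/
theorem isUnit_KTstY_avYOfRecord_of_small (x : MemberY θ.d₆ θ.ℓ₆ θ.hd' θ.hL' θ.b₀ θ.b₁ Mstar) {G : Subgroup (Matrix (Fin N) (Fin N) ℂ)ˣ}
    (hG : G ≤ unitaryUnits (Matrix (Fin N) (Fin N) ℂ)) {U : CfgY (Matrix (Fin N) (Fin N) ℂ) x.toKIdx} (hU : ∀ μ z, U μ z ∈ G) {δ : ℝ} (hδ0 : 0 ≤ δ)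
    (hδ : ∀ b, ‖((avYOfRecord x U b : (Matrix (Fin N) (Fin N) ℂ)ˣ) : Matrix (Fin N) (Fin N) ℂ) - 1‖ ≤ δ)
    (hsmall : (((θ.ℓ₆ + 1 : ℕ) : ℝ)) ^ (θ.d₆ + 1) * (2 * δ * (((θ.ℓ₆ + 1 : ℕ) + (θ.d₆ + 1) * θ.ℓ₆ : ℕ) : ℝ)) < 1) (c : CBondStY x) :
    IsUnit (KTstY x (avYOfRecord x) U c) :=
  isUnit_KTstY_of_smallVY x (avYOfRecord x) (smallVY_avYOfRecord N θ Mstar x hG hU hδ0 hδ hsmall) c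

/-- ★★ **THE v7 STAR RECORD'S `C ∕ C*` ARE TRACE-TRANSPOSES OF EACH OTHER IN THE SMALL-FIELD REGIME — NO `IsUnit` HYPOTHESES** (part 3's
`sum_trace_elimC_elimCt_sectEStYOfRecordV7 (hK) (hKT)` with both binders discharged). [cite: Balaban1985BackgroundPropagators, (3.157) p.428 («C*»), (3.9) p.392, (3.35) p.397] -/
theorem sum_trace_elimC_elimCt_sectEStYOfRecordV7_of_smallVY (x : MemberY θ.d₆ θ.ℓ₆ θ.hd' θ.hL' θ.b₀ θ.b₁ Mstar)
    {G : Subgroup (Matrix (Fin N) (Fin N) ℂ)ˣ} {U : CfgY (Matrix (Fin N) (Fin N) ℂ) x.toKIdx} {δ : ℝ} (h : SmallVY x (avYOfRecord x) G U δ)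
    (B A : IBondY x.toKIdx → Matrix (Fin N) (Fin N) ℂ) :
    ∑ q, Matrix.trace ((sectEStYOfRecordV7 N θ Mstar 𝔢₀ x).elimC U B q * A q) =
      ∑ q, Matrix.trace (B q * (sectEStYOfRecordV7 N θ Mstar 𝔢₀ x).elimCt U A q) :=
  sum_trace_elimC_elimCt_sectEStYOfRecordV7 N θ Mstar 𝔢₀ x U (isUnit_KstY_of_smallVY x _ h) (isUnit_KTstY_of_smallVY x _ h) B A

/-- ★★ **THE v7 STAR RECORD'S `C` MAPS INTO THE CONSTRAINED STAR SUBSPACE IN THE SMALL-FIELD REGIME**: `(Q(V)(C B))(c) = 0` at every star corner, no `IsUnit`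
hypothesis. [cite: Balaban1985BackgroundPropagators, (3.157) p.428; Balaban1985Averaging, (125) p.36; Balaban1984PropagatorsII, Lemma 2.4 p.245] -/
theorem Q1Y_elimC_sectEStYOfRecordV7_of_smallVY (x : MemberY θ.d₆ θ.ℓ₆ θ.hd' θ.hL' θ.b₀ θ.b₁ Mstar)
    {G : Subgroup (Matrix (Fin N) (Fin N) ℂ)ˣ} {U : CfgY (Matrix (Fin N) (Fin N) ℂ) x.toKIdx} {δ : ℝ} (h : SmallVY x (avYOfRecord x) G U δ)
    (c : CBondStY x) (B : IBondY x.toKIdx → Matrix (Fin N) (Fin N) ℂ) :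
    Q1Y x (avYOfRecord x) U c.1 ((sectEStYOfRecordV7 N θ Mstar 𝔢₀ x).elimC U B) = 0 :=
  Q1Y_elimCstY_of_smallVY x _ h c B

/-- ★★ **THE v7 STAR RECORD'S `C` PARAMETRISES THE CONSTRAINED STAR SUBSPACE IN THE SMALL-FIELD REGIME** (print's «B = CB̃», B̃ = B on Λ̃), no `IsUnit`
hypothesis. [cite: Balaban1985BackgroundPropagators, (3.157) p.428; Balaban1984PropagatorsII, (2.154)–(2.156) pp.249–250] -/
theorem elimC_sectEStYOfRecordV7_eq_self_of_constraints_of_smallVY (x : MemberY θ.d₆ θ.ℓ₆ θ.hd' θ.hL' θ.b₀ θ.b₁ Mstar)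
    {G : Subgroup (Matrix (Fin N) (Fin N) ℂ)ˣ} {U : CfgY (Matrix (Fin N) (Fin N) ℂ) x.toKIdx} {δ : ℝ} (h : SmallVY x (avYOfRecord x) G U δ)
    (B : IBondY x.toKIdx → Matrix (Fin N) (Fin N) ℂ) (hsupp : ∀ q, ¬ lamTstY x q → ¬ IsPivStY x q → B q = 0)
    (hQ : ∀ c : CBondStY x, Q1Y x (avYOfRecord x) U c.1 B = 0) : (sectEStYOfRecordV7 N θ Mstar 𝔢₀ x).elimC U B = B :=
  elimCstY_eq_self_of_constraints_of_smallVY x _ h B hsupp hQ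

/-- ★★ **THE DOOR TRIPLE AT THE v7 STAR RECORD OF A STAGE 3′(Y) FAMILY, GENERAL SMALL BACKGROUND** (`(sectEStYOfRecordV7 N θ M⋆ 𝔢₀ x).elimC U = C_st(V(U))`):
the door's `B := C(V)Φ` at the star instance lies in print's `V`-constrained star subspace, for every member `x`, every `Φ` and every `U` with
`SmallVY x (avYOfRecord x) G U δ` (part 3 §7's `sectEStYOfRecordV7_elimC_one_mem_starSubspace` off `U = 1`). [cite: Balaban1985BackgroundPropagators, (3.156)–(3.157) p.428, (3.35) p.397; Balaban1984PropagatorsII, (2.3) p.224, Lemma 2.4 p.245] -/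
theorem sectEStYOfRecordV7_elimC_mem_starSubspace_of_smallVY (x : MemberY θ.d₆ θ.ℓ₆ θ.hd' θ.hL' θ.b₀ θ.b₁ Mstar)
    {G : Subgroup (Matrix (Fin N) (Fin N) ℂ)ˣ} {U : CfgY (Matrix (Fin N) (Fin N) ℂ) x.toKIdx} {δ : ℝ} (h : SmallVY x (avYOfRecord x) G U δ)
    (Φ : IBondY x.toKIdx → Matrix (Fin N) (Fin N) ℂ) :
    (∀ q, ¬ inΛstY x q → (sectEStYOfRecordV7 N θ Mstar 𝔢₀ x).elimC U Φ q = 0) ∧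
      (∀ q, IsAxialY x q → (sectEStYOfRecordV7 N θ Mstar 𝔢₀ x).elimC U Φ q = 0) ∧
      (∀ c : CBondStY x, Q1Y x (avYOfRecord x) U c.1 ((sectEStYOfRecordV7 N θ Mstar 𝔢₀ x).elimC U Φ) = 0) :=
  elimCstY_mem_starSubspace_of_smallVY x _ h Φ

end RecordV7Small

end Literature.MathematicalPhysics.QuantumFieldTheory.Balaban1983to89.Node00
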